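import Summits.QuantumFields.YangMills.Theorems.LogConcaveChartTransportRemainderVariance
import Literature.Probability.Moments.CovarianceFreezing

/-!
# Route `LogConcaveChart` — toolkit for the support item `TransportCovarianceTransfer`
(stmt-QuantumFields-23668, child of the transport split of crux `QuadraticCovarianceComparison`,
stmt-QuantumFields-26240): **the isotropic, purely Gaussian form of the covariance transfer**

Let `γ = 𝒩(0, I_n)`, `q_f(y) = yᵀH_f y + b_f·y`, `q_g(y) = yᵀH_g y + b_g·y` (`H_f, H_g` symmetric), and
`T : ℝⁿ → ℝⁿ` a `C¹` map with `|DT(x)u − u|² ≤ δ²|u|²`, `T − id` `δ`-Lipschitz and centred displacement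
`∫ (T − id) dγ = 0`, `0 ≤ δ ≤ 1/2`.  Then (`covariance_transport_isotropic`)

  `|Cov_γ(q_f ∘ T, q_g ∘ T) − (2 tr(H_f H_g) + b_f·b_g)| ≤ C · δ · √(rV_f · rV_g)`,
  `rV_f = 2 tr(H_f²) + |b_f|²`, `C = 2√K + K/2`, `K = 3π² + π⁴/4`.

This is the heart of the transport proof of the covariance comparison, with NO dependence on `n`:
`Cov_γ(q_f ∘ T, q_g ∘ T) = Cov(q_f, q_g) + Cov(q_f, R_g) + Cov(R_f, q_g) + Cov(R_f, R_g)` with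
`R = q ∘ T − q`; the Gaussian term is `2 tr(H_f H_g) + b_f·b_g` (Isserlis, `covariance_quadObs_pi`),
`Var_γ q_f = rV_f`, `Var_γ R_f ≤ K δ² rV_f` (`variance_remainder_le`), and Cauchy–Schwarz for the
covariance (`Literature.Probability.Moments.covariance_sq_le_variance_mul`).  The measure `e^{−A}` of
the item enters only through the pushforward identity `ν = T_# γ`, handled in a separate file.

HONEST SCOPE. Helper theorem toward ONE support item of a sub-line; nothing here proves
`TransportCovarianceTransfer` (general `H₀`, density form), `QuadraticCovarianceComparison`, the
`LogConcaveChart` thesis, rung R2a (`BalabanLadder.NT`) or any summit statement; the Yang–Mills mass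
gap is NOT proved.  Filed by ideator seat ym-idea-8 (generation 8, lens «dual» = transport side).
-/

namespace Summit.QuantumFields.YangMills.Cruxes.TransportCovarianceTransfer

open MeasureTheory ProbabilityTheory
open scoped NNReal ENNReal

variable {n : ℕ}

/-- For symmetric `H`: `tr(H²) = ∑ᵢⱼ Hᵢⱼ² = ‖H‖_F²`. [folklore] -/
theorem trace_mul_self_of_isSymm {H : Matrix (Fin n) (Fin n) ℝ} (hH : H.IsSymm) :
    (H * H).trace = ∑ i, ∑ j, H i j ^ 2 := by
  simp only [Matrix.trace, Matrix.diag, Matrix.mul_apply, sq]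
  exact Finset.sum_congr rfl fun i _ => Finset.sum_congr rfl fun j _ => by rw [hH.apply j i]

/-- `√(a · (K δ² c)) = δ √K √(a c)` bookkeeping: if `0 ≤ δ`, `0 ≤ K`, `x ≤ a * (K * δ ^ 2 * c)` with
`0 ≤ a`, then `√x ≤ δ * √K * √(a * c)`. [folklore] -/
theorem sqrt_le_delta_sqrt {δ K a c x : ℝ} (hδ : 0 ≤ δ) (hK : 0 ≤ K) (hx : x ≤ a * (K * δ ^ 2 * c)) :
    Real.sqrt x ≤ δ * Real.sqrt K * Real.sqrt (a * c) := by
  have e : a * (K * δ ^ 2 * c) = (δ ^ 2 * K) * (a * c) := by ring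
  calc Real.sqrt x ≤ Real.sqrt (a * (K * δ ^ 2 * c)) := Real.sqrt_le_sqrt hx
    _ = δ * Real.sqrt K * Real.sqrt (a * c) := by
        rw [e, Real.sqrt_mul (by positivity), Real.sqrt_mul (sq_nonneg δ), Real.sqrt_sq hδ]

/-- **Covariance transfer, isotropic Gaussian form (dimension-free).** See the module docstring.
[folklore] -/
theorem covariance_transport_isotropic {δ : ℝ} (hδ : 0 ≤ δ) (hδ1 : δ ≤ 1 / 2)
    {Hf Hg : Matrix (Fin n) (Fin n) ℝ} (hHf : Hf.IsSymm) (hHg : Hg.IsSymm) (bf bg : Fin n → ℝ)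
    {T : (Fin n → ℝ) → (Fin n → ℝ)} (hT : ContDiff ℝ 1 T)
    (hD : ∀ x u : Fin n → ℝ, (fderiv ℝ T x u - u) ⬝ᵥ (fderiv ℝ T x u - u) ≤ δ ^ 2 * (u ⬝ᵥ u))
    (hLip : ∀ x y, (T x - T y - (x - y)) ⬝ᵥ (T x - T y - (x - y)) ≤ δ ^ 2 * ((x - y) ⬝ᵥ (x - y)))
    (hc : ∀ i, ∫ x, (T x - x) i ∂(Measure.pi fun _ : Fin n => gaussianReal 0 1) = 0) :
    |(∫ x, (T x ⬝ᵥ Hf.mulVec (T x) + bf ⬝ᵥ T x) * (T x ⬝ᵥ Hg.mulVec (T x) + bg ⬝ᵥ T x)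
          ∂(Measure.pi fun _ : Fin n => gaussianReal 0 1)) -
        (∫ x, T x ⬝ᵥ Hf.mulVec (T x) + bf ⬝ᵥ T x ∂(Measure.pi fun _ : Fin n => gaussianReal 0 1)) *
          (∫ x, T x ⬝ᵥ Hg.mulVec (T x) + bg ⬝ᵥ T x ∂(Measure.pi fun _ : Fin n => gaussianReal 0 1)) -
        (2 * (Hf * Hg).trace + bf ⬝ᵥ bg)| ≤
      (2 * Real.sqrt (3 * Real.pi ^ 2 + Real.pi ^ 4 / 4) + (3 * Real.pi ^ 2 + Real.pi ^ 4 / 4) / 2) *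
        δ * Real.sqrt ((2 * (Hf * Hf).trace + bf ⬝ᵥ bf) * (2 * (Hg * Hg).trace + bg ⬝ᵥ bg)) := by
  set γ : Measure (Fin n → ℝ) := Measure.pi fun _ : Fin n => gaussianReal 0 1 with hγ
  set K : ℝ := 3 * Real.pi ^ 2 + Real.pi ^ 4 / 4 with hK
  have hK0 : 0 ≤ K := by rw [hK]; positivity
  -- the four functions
  set qf : (Fin n → ℝ) → ℝ := fun x => x ⬝ᵥ Hf.mulVec x + bf ⬝ᵥ x with hqf
  set qg : (Fin n → ℝ) → ℝ := fun x => x ⬝ᵥ Hg.mulVec x + bg ⬝ᵥ x with hqg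
  set Φ : (Fin n → ℝ) → ℝ := fun x => T x ⬝ᵥ Hf.mulVec (T x) + bf ⬝ᵥ T x with hΦ
  set Ψ : (Fin n → ℝ) → ℝ := fun x => T x ⬝ᵥ Hg.mulVec (T x) + bg ⬝ᵥ T x with hΨ
  set Rf : (Fin n → ℝ) → ℝ := fun x => Φ x - qf x with hRf
  set Rg : (Fin n → ℝ) → ℝ := fun x => Ψ x - qg x with hRg
  -- square integrability
  obtain ⟨-, iΦ2⟩ := integrable_quadObs_comp hT.continuous hLip Hf bf
  obtain ⟨-, iΨ2⟩ := integrable_quadObs_comp hT.continuous hLip Hg bg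
  obtain ⟨-, iqf2⟩ := integrable_quadObs (n := n) Hf bf
  obtain ⟨-, iqg2⟩ := integrable_quadObs (n := n) Hg bg
  have cΦ : Continuous Φ := continuous_quadObs_comp hT.continuous Hf bf
  have cΨ : Continuous Ψ := continuous_quadObs_comp hT.continuous Hg bg
  have cqf : Continuous qf := continuous_quadObs_comp (T := fun z => z) continuous_id Hf bf
  have cqg : Continuous qg := continuous_quadObs_comp (T := fun z => z) continuous_id Hg bg
  have mΦ : MemLp Φ 2 γ := (memLp_two_iff_integrable_sq cΦ.aestronglyMeasurable).2 iΦ2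
  have mΨ : MemLp Ψ 2 γ := (memLp_two_iff_integrable_sq cΨ.aestronglyMeasurable).2 iΨ2
  have mqf : MemLp qf 2 γ := (memLp_two_iff_integrable_sq cqf.aestronglyMeasurable).2 iqf2
  have mqg : MemLp qg 2 γ := (memLp_two_iff_integrable_sq cqg.aestronglyMeasurable).2 iqg2
  have mRf : MemLp Rf 2 γ := mΦ.sub mqf
  have mRg : MemLp Rg 2 γ := mΨ.sub mqg
  -- covariance decomposition
  have eΦ : Φ = qf + Rf := by funext x; simp only [Pi.add_apply, hRf]; ring
  have eΨ : Ψ = qg + Rg := by funext x; simp only [Pi.add_apply, hRg]; ring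
  have hsplit : cov[Φ, Ψ; γ] =
      cov[qf, qg; γ] + cov[qf, Rg; γ] + (cov[Rf, qg; γ] + cov[Rf, Rg; γ]) := by
    rw [eΦ, eΨ, covariance_add_left mqf mRf (mqg.add mRg), covariance_add_right mqf mqg mRg,
      covariance_add_right mRf mqg mRg]
  -- the Gaussian term
  have hqq : cov[qf, qg; γ] = 2 * (Hf * Hg).trace + bf ⬝ᵥ bg := by
    rw [covariance_eq_sub mqf mqg]
    have h := covariance_quadObs_pi Hf Hg hHg bf bg
    simp only [Pi.mul_apply]
    exact h
  -- variances of the quadratic observables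
  have hVf : Var[qf; γ] = 2 * (Hf * Hf).trace + bf ⬝ᵥ bf := by
    rw [← covariance_self mqf.aemeasurable, covariance_eq_sub mqf mqf]
    have h := covariance_quadObs_pi Hf Hf hHf bf bf
    simp only [Pi.mul_apply]
    exact h
  have hVg : Var[qg; γ] = 2 * (Hg * Hg).trace + bg ⬝ᵥ bg := by
    rw [← covariance_self mqg.aemeasurable, covariance_eq_sub mqg mqg]
    have h := covariance_quadObs_pi Hg Hg hHg bg bg
    simp only [Pi.mul_apply]
    exact h
  -- variances of the remainders
  set a : ℝ := 2 * (Hf * Hf).trace + bf ⬝ᵥ bf with ha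
  set c : ℝ := 2 * (Hg * Hg).trace + bg ⬝ᵥ bg with hc'
  have hFf : (∑ i, ∑ j, Hf i j ^ 2) + bf ⬝ᵥ bf ≤ a := by
    rw [ha, trace_mul_self_of_isSymm hHf]
    have : 0 ≤ ∑ i, ∑ j, Hf i j ^ 2 :=
      Finset.sum_nonneg fun i _ => Finset.sum_nonneg fun j _ => sq_nonneg _
    linarith
  have hFg : (∑ i, ∑ j, Hg i j ^ 2) + bg ⬝ᵥ bg ≤ c := by
    rw [hc', trace_mul_self_of_isSymm hHg]
    have : 0 ≤ ∑ i, ∑ j, Hg i j ^ 2 :=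
      Finset.sum_nonneg fun i _ => Finset.sum_nonneg fun j _ => sq_nonneg _
    linarith
  have ha0 : 0 ≤ a := le_trans (by
    have h1 : 0 ≤ ∑ i, ∑ j, Hf i j ^ 2 :=
      Finset.sum_nonneg fun i _ => Finset.sum_nonneg fun j _ => sq_nonneg _
    have h2 : 0 ≤ bf ⬝ᵥ bf := Finset.sum_nonneg fun _ _ => mul_self_nonneg _
    linarith) hFf
  have hc0 : 0 ≤ c := le_trans (by
    have h1 : 0 ≤ ∑ i, ∑ j, Hg i j ^ 2 :=
      Finset.sum_nonneg fun i _ => Finset.sum_nonneg fun j _ => sq_nonneg _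
    have h2 : 0 ≤ bg ⬝ᵥ bg := Finset.sum_nonneg fun _ _ => mul_self_nonneg _
    linarith) hFg
  have hKδ : 0 ≤ K * δ ^ 2 := by positivity
  have hVRf : Var[Rf; γ] ≤ K * δ ^ 2 * a := by
    rw [variance_eq_sub mRf]
    have h := variance_remainder_le hδ hδ1 hHf bf hT hD hLip hc
    simp only [Pi.pow_apply]
    calc (∫ x, Rf x ^ 2 ∂γ) - (∫ x, Rf x ∂γ) ^ 2
        ≤ (3 * Real.pi ^ 2 + Real.pi ^ 4 / 4) * δ ^ 2 * ((∑ i, ∑ j, Hf i j ^ 2) + bf ⬝ᵥ bf) := h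
      _ ≤ K * δ ^ 2 * a := by rw [hK]; exact mul_le_mul_of_nonneg_left hFf hKδ
  have hVRg : Var[Rg; γ] ≤ K * δ ^ 2 * c := by
    rw [variance_eq_sub mRg]
    have h := variance_remainder_le hδ hδ1 hHg bg hT hD hLip hc
    simp only [Pi.pow_apply]
    calc (∫ x, Rg x ^ 2 ∂γ) - (∫ x, Rg x ∂γ) ^ 2
        ≤ (3 * Real.pi ^ 2 + Real.pi ^ 4 / 4) * δ ^ 2 * ((∑ i, ∑ j, Hg i j ^ 2) + bg ⬝ᵥ bg) := h
      _ ≤ K * δ ^ 2 * c := by rw [hK]; exact mul_le_mul_of_nonneg_left hFg hKδ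
  have hV0f : 0 ≤ Var[Rf; γ] := variance_nonneg _ _
  have hV0g : 0 ≤ Var[Rg; γ] := variance_nonneg _ _
  -- Cauchy–Schwarz for the three cross terms
  have cs1 : |cov[qf, Rg; γ]| ≤ δ * Real.sqrt K * Real.sqrt (a * c) := by
    refine le_trans (Real.abs_le_sqrt
      (Literature.Probability.Moments.covariance_sq_le_variance_mul mqf mRg)) ?_
    refine sqrt_le_delta_sqrt hδ hK0 ?_
    rw [hVf]
    exact mul_le_mul_of_nonneg_left hVRg ha0
  have cs2 : |cov[Rf, qg; γ]| ≤ δ * Real.sqrt K * Real.sqrt (a * c) := by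
    refine le_trans (Real.abs_le_sqrt
      (Literature.Probability.Moments.covariance_sq_le_variance_mul mRf mqg)) ?_
    have h : Var[Rf; γ] * Var[qg; γ] ≤ a * (K * δ ^ 2 * c) := by
      rw [hVg]
      calc Var[Rf; γ] * c ≤ K * δ ^ 2 * a * c := mul_le_mul_of_nonneg_right hVRf hc0
        _ = a * (K * δ ^ 2 * c) := by ring
    exact sqrt_le_delta_sqrt hδ hK0 h
  have cs3 : |cov[Rf, Rg; γ]| ≤ K * δ ^ 2 * Real.sqrt (a * c) := by
    refine le_trans (Real.abs_le_sqrt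
      (Literature.Probability.Moments.covariance_sq_le_variance_mul mRf mRg)) ?_
    have h : Var[Rf; γ] * Var[Rg; γ] ≤ (K * δ ^ 2) ^ 2 * (a * c) := by
      calc Var[Rf; γ] * Var[Rg; γ] ≤ (K * δ ^ 2 * a) * (K * δ ^ 2 * c) :=
            mul_le_mul hVRf hVRg hV0g (by positivity)
        _ = (K * δ ^ 2) ^ 2 * (a * c) := by ring
    calc Real.sqrt (Var[Rf; γ] * Var[Rg; γ]) ≤ Real.sqrt ((K * δ ^ 2) ^ 2 * (a * c)) :=
          Real.sqrt_le_sqrt h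
      _ = K * δ ^ 2 * Real.sqrt (a * c) := by
          rw [Real.sqrt_mul (sq_nonneg _), Real.sqrt_sq hKδ]
  -- assemble
  have hcov : cov[Φ, Ψ; γ] = (∫ x, Φ x * Ψ x ∂γ) - (∫ x, Φ x ∂γ) * (∫ x, Ψ x ∂γ) := by
    rw [covariance_eq_sub mΦ mΨ]
    simp only [Pi.mul_apply]
  rw [← hcov, hsplit, hqq]
  have e : 2 * (Hf * Hg).trace + bf ⬝ᵥ bg + cov[qf, Rg; γ] + (cov[Rf, qg; γ] + cov[Rf, Rg; γ]) -
      (2 * (Hf * Hg).trace + bf ⬝ᵥ bg) = cov[qf, Rg; γ] + cov[Rf, qg; γ] + cov[Rf, Rg; γ] := by ring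
  rw [e]
  have hS0 : 0 ≤ Real.sqrt (a * c) := Real.sqrt_nonneg _
  have hsK : 0 ≤ Real.sqrt K := Real.sqrt_nonneg _
  have hδ2 : K * δ ^ 2 ≤ K / 2 * δ := by
    have h : δ ^ 2 ≤ 1 / 2 * δ := by nlinarith
    have h' := mul_le_mul_of_nonneg_left h hK0
    linarith
  calc |cov[qf, Rg; γ] + cov[Rf, qg; γ] + cov[Rf, Rg; γ]|
      ≤ |cov[qf, Rg; γ]| + |cov[Rf, qg; γ]| + |cov[Rf, Rg; γ]| := abs_add_three _ _ _
    _ ≤ δ * Real.sqrt K * Real.sqrt (a * c) + δ * Real.sqrt K * Real.sqrt (a * c) +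
          K * δ ^ 2 * Real.sqrt (a * c) := by linarith
    _ ≤ (2 * Real.sqrt K + K / 2) * δ * Real.sqrt (a * c) := by
          nlinarith [mul_le_mul_of_nonneg_right hδ2 hS0]

end Summit.QuantumFields.YangMills.Cruxes.TransportCovarianceTransfer
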